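/-
Copyright (c) 2026 the pub-hodgecm-mathlib formalisation cell (harness21).  Prover seat hodgecm-mathlib-K2Liu-p08 (g0), Track B «K2-LIT»,
#184♮ = hLiu418 = `stmt-HodgeConjecture-24832`; K2E5-plan (g5) CO-DEAL 2026-09-04T06:39:00Z «G1.1 NOW, BY VALUE on §G2-OUT» (SIGS v3.3∕v3.4 §7),
LEAD F0P6-plan (g12) M-156e (O2).  Road I v3, organ G1, file 3 (the term-wise side); inputs ★ G1 files 1–2 (p857965, p857984), ★ U0.
-/
import Summits.HodgeConjecture.HodgeConjecture.Theorems.K2LiuResidueLieDerivative   -- ★ G1 files 1–2 (continuation side, residue form)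
import Mathlib.Analysis.Calculus.SmoothSeries
import HarnessLib

/-!
# Crux `HLiu418`, Road I v3, organ G1 file 3 (G1.1): TERM-WISE `t`-DERIVATIVE OF THE CONVERGENT EISENSTEIN SERIES ALONG AN ORBIT, and the
# assembled G1 chain «section-level derivative (§G2-OUT, BY VALUE) ⇒ derivative of the continuation and of the residue form»

Cell `hodgecm-mathlib`, crux item hLiu418 = `stmt-HodgeConjecture-24832`; co-dealer K2E5-plan (g5) (SIGS-RoadI-v3.3∕v3.4 §7 «§G2-OUT» = CENSUS-G1 §3 wording),
LEAD F0P6-plan (g12); boxes K2E5-r01 (g6) ∕ K2Liu-ref1 (g2).  THEOREMS ONLY (no `def`, no instance, no notation, no named-fact hypothesis, no `sorry`); lane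
`--supports stmt-HodgeConjecture-24832 --as helper` (count-neutral).  Consumers: Hol, U5 (with G2 `K2LiuInfinitesimalWeilAction` discharging the BY-VALUE
section-level hypotheses for Siegel–Weil families).

THE MATHEMATICS.
* §1 (G1.1) `hasDerivAt_eisensteinFamilyDelta_orbit`: for families `f, f′ : ℂ → H(𝔸) → ℂ` and an orbit `γ : ℝ → H(𝔸)` with the SECTION-LEVEL identity
  `∂_t f_s(h · γ t) = f′_s(h · γ t)` for every left translate `h` (§G2-OUT, BY VALUE), summability of `Σ_q f_s(q·γ 0)` and a SEGMENT-UNIFORM SUMMABLE MAJORANT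
  of the derived terms `‖f′_s(q·γ t)‖ ≤ u_q` (`|t| < R`) on `{s₁ < re}` (★ #9-type data, BY VALUE; for standard families `f′ = Σ cᵢ(s)fᵢ` it is ★ #9's majorant
  termwise): `∂_t E^Δ(f_s)(γ t) = E^Δ(f′_s)(γ t)` on `{s₁ < re}` (Mathlib `hasDerivAt_tsum_of_isPreconnected` on `(−R, R)`).
* §2 from clause (iv) of socket #41 for two pole-cleared continuations `(P, E⋆)` of `f` and `(P′, E′)` of `f′`, §1 IS the hypothesis `hterm` of ★ G1 file 1 on the
  half-plane to the right of all roots (`hterm_of_termwise`); hence the ASSEMBLED CHAIN: `hasDerivAt_continuation_orbit_of_termwise` (★ file 1) and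
  **`hasDerivAt_resNorm_orbit_of_termwise`** (★ file 2): `∂_t resNorm P E⋆ (γ t) = resNorm P′ E′ (γ t)`, all hypotheses BY VALUE in the #41∕#9∕§G2-OUT currency.
[MoeglinWaldspurger1995, IV.1.9–IV.1.11; II.1.7 (term-wise differentiation of Eisenstein series in the domain of convergence)] [BorelJacquet1979, §4.1]
[KudlaRallis1994, §1 Thm. 1.1] [Liu2021, Lem. B.12].
HONEST LABEL.  Count-neutral helper; G1 closes no socket by itself; `HC_CM` is proved only modulo the 7 printed citations (2 remaining named inputs:
hLiu418 = `stmt-HodgeConjecture-24832`, h413 = `stmt-HodgeConjecture-24833`) until rung 0 closes.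
-/

set_option autoImplicit false
set_option linter.dupNamespace false -- the mandated namespace repeats `HodgeConjecture.HodgeConjecture`
set_option Elab.async false

noncomputable section

open NumberField IsDedekindDomain Filter Metric Set Complex
open scoped Topology BigOperators

namespace Summit.HodgeConjecture.HodgeConjecture.Cruxes.HLiu418.K2LiuEisensteinTermwiseLieDerivative

open Literature.NumberTheory.Automorphic
open Literature.NumberTheory.GaloisRepresentations
open Literature.NumberTheory.GelbartRogawski1991 Literature.NumberTheory.GelbartRogawski1991.GRConstruction
open Literature.NumberTheory.K2Lit.SiegelDoubled
open Summit.HodgeConjecture.HodgeConjecture.Cruxes.HLiu418.K2LiuFirstTermResidueFormDefs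
open Summit.HodgeConjecture.HodgeConjecture.Cruxes.HLiu418.K2LiuContinuationLieDerivative
open Summit.HodgeConjecture.HodgeConjecture.Cruxes.HLiu418.K2LiuResidueLieDerivative
open Summit.HodgeConjecture.HodgeConjecture.Cruxes.HLiu418.K2LiuEisensteinResidueOfGenerators (prod_sub_ne_zero not_mem_of_sum_norm_lt_re)

section Frame

variable (L : Type) [Field L] [NumberField L] [IsCMField L]
variable {N M n : ℕ} (e : Fin N × Fin M ≃ Fin n)
  (dV : Fin N → L) (hdV : ∀ i, IsCMField.complexConj L (dV i) = dV i)
  (dW : Fin M → L) (hdW : ∀ i, IsCMField.complexConj L (dW i) = dW i)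

/-! ## §1 (G1.1) term-wise differentiation of the convergent series along an orbit -/

/-- **G1.1 — TERM-WISE `t`-DERIVATIVE OF THE EISENSTEIN SERIES ALONG AN ORBIT.**  `f, f′ : ℂ → H(𝔸) → ℂ`, `γ : ℝ → H(𝔸)`; section-level identity
`hX : HasDerivAt (fun t => f s (h * γ t)) (f′ s (h * γ t)) t` for all `s, h, t` (§G2-OUT BY VALUE); on `{s₁ < re}`: the series `Σ_q f_s(q · γ 0)` is summable and the
derived terms have a SUMMABLE MAJORANT uniform on every segment `|t| < R`.  Then `HasDerivAt (fun t => E^Δ(f_s)(γ t)) (E^Δ(f′_s)(γ t)) t` for `s₁ < re s`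
(★ `eisensteinFamilyDelta`). [cite: MoeglinWaldspurger1995, II.1.7] [cite: BorelJacquet1979, §4.1] -/
theorem hasDerivAt_eisensteinFamilyDelta_orbit (f f' : ℂ → HA L e dV hdV dW hdW → ℂ) (γ : ℝ → HA L e dV hdV dW hdW)
    (hX : ∀ (s : ℂ) (h : HA L e dV hdV dW hdW) (t : ℝ), HasDerivAt (fun t => f s (h * γ t)) (f' s (h * γ t)) t)
    {s₁ : ℝ}
    (hsum : ∀ s : ℂ, s₁ < s.re → Summable fun q : SiegelDeltaQuot L e dV hdV dW hdW =>
      f s (((Quotient.out q : ratH L e dV hdV dW hdW) : HA L e dV hdV dW hdW) * γ 0))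
    (hmaj : ∀ s : ℂ, s₁ < s.re → ∀ R : ℝ, ∃ u : SiegelDeltaQuot L e dV hdV dW hdW → ℝ, Summable u ∧
      ∀ t : ℝ, |t| < R → ∀ q : SiegelDeltaQuot L e dV hdV dW hdW,
        ‖f' s (((Quotient.out q : ratH L e dV hdV dW hdW) : HA L e dV hdV dW hdW) * γ t)‖ ≤ u q)
    (s : ℂ) (hs : s₁ < s.re) (t : ℝ) :
    HasDerivAt (fun t => eisensteinFamilyDelta L e dV hdV dW hdW f s (γ t)) (eisensteinFamilyDelta L e dV hdV dW hdW f' s (γ t)) t := by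
  obtain ⟨u, hu, hub⟩ := hmaj s hs (|t| + 1)
  have h0 : (0 : ℝ) ∈ Ioo (-(|t| + 1)) (|t| + 1) := by
    constructor <;> linarith [abs_nonneg t]
  have ht : t ∈ Ioo (-(|t| + 1)) (|t| + 1) := by
    constructor <;> linarith [neg_abs_le t, le_abs_self t]
  have habs : ∀ y ∈ Ioo (-(|t| + 1)) (|t| + 1), |y| < |t| + 1 := fun y hy => abs_lt.2 ⟨hy.1, hy.2⟩
  have key := hasDerivAt_tsum_of_isPreconnected (𝕜 := ℝ) (F := ℂ)
    (g := fun (q : SiegelDeltaQuot L e dV hdV dW hdW) (y : ℝ) =>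
      f s (((Quotient.out q : ratH L e dV hdV dW hdW) : HA L e dV hdV dW hdW) * γ y))
    (g' := fun (q : SiegelDeltaQuot L e dV hdV dW hdW) (y : ℝ) =>
      f' s (((Quotient.out q : ratH L e dV hdV dW hdW) : HA L e dV hdV dW hdW) * γ y))
    hu isOpen_Ioo isPreconnected_Ioo (fun q y _ => hX s _ y) (fun q y hy => hub y (habs y hy) q) h0 (hsum s hs) ht
  exact key

/-! ## §2 The assembled chain: term-wise ⇒ continuation ⇒ residue form -/

/-- **clause (iv) turns G1.1 into the `hterm` of ★ G1 file 1**: to the right of all roots of both clearing polynomials, `E⋆/∏_P = E^Δ(f_s)` and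
`E′/∏_{P′} = E^Δ(f′_s)`, so the term-wise identity of §1 is the quotient identity required by ★ `hasDerivAt_continuation_orbit`. [cite: MoeglinWaldspurger1995, IV.1.9] -/
theorem hterm_of_termwise (f f' : ℂ → HA L e dV hdV dW hdW → ℂ) (γ : ℝ → HA L e dV hdV dW hdW)
    (hX : ∀ (s : ℂ) (h : HA L e dV hdV dW hdW) (t : ℝ), HasDerivAt (fun t => f s (h * γ t)) (f' s (h * γ t)) t)
    {s₁ : ℝ}
    (hsum : ∀ s : ℂ, s₁ < s.re → Summable fun q : SiegelDeltaQuot L e dV hdV dW hdW =>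
      f s (((Quotient.out q : ratH L e dV hdV dW hdW) : HA L e dV hdV dW hdW) * γ 0))
    (hmaj : ∀ s : ℂ, s₁ < s.re → ∀ R : ℝ, ∃ u : SiegelDeltaQuot L e dV hdV dW hdW → ℝ, Summable u ∧
      ∀ t : ℝ, |t| < R → ∀ q : SiegelDeltaQuot L e dV hdV dW hdW,
        ‖f' s (((Quotient.out q : ratH L e dV hdV dW hdW) : HA L e dV hdV dW hdW) * γ t)‖ ≤ u q)
    (P : Finset ℂ) (Es : ℂ → HA L e dV hdV dW hdW → ℂ)
    (hiv : ∀ (s : ℂ) (h : HA L e dV hdV dW hdW), (n : ℝ) / 2 < s.re →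
      Es s h = (∏ p ∈ P, (s - p)) * eisensteinFamilyDelta L e dV hdV dW hdW f s h)
    (P' : Finset ℂ) (E' : ℂ → HA L e dV hdV dW hdW → ℂ)
    (hiv' : ∀ (s : ℂ) (h : HA L e dV hdV dW hdW), (n : ℝ) / 2 < s.re →
      E' s h = (∏ p ∈ P', (s - p)) * eisensteinFamilyDelta L e dV hdV dW hdW f' s h) :
    ∀ s : ℂ, max s₁ ((n : ℝ) / 2) + (∑ p ∈ P, ‖p‖ + ∑ p ∈ P', ‖p‖) < s.re → ∀ t : ℝ,
      HasDerivAt (fun t => Es s (γ t) / ∏ p ∈ P, (s - p)) (E' s (γ t) / ∏ p ∈ P', (s - p)) t := by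
  intro s hs t
  have hP0 : 0 ≤ ∑ p ∈ P, ‖p‖ := Finset.sum_nonneg fun p _ => norm_nonneg p
  have hP0' : 0 ≤ ∑ p ∈ P', ‖p‖ := Finset.sum_nonneg fun p _ => norm_nonneg p
  have hn0 : (0 : ℝ) ≤ (n : ℝ) / 2 := by positivity
  have hmx : (n : ℝ) / 2 ≤ max s₁ ((n : ℝ) / 2) := le_max_right _ _
  have hs₁ : s₁ < s.re := by linarith [le_max_left s₁ ((n : ℝ) / 2)]
  have hsn : (n : ℝ) / 2 < s.re := by linarith
  have hsP : s ∉ P := not_mem_of_sum_norm_lt_re P (by linarith)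
  have hsP' : s ∉ P' := not_mem_of_sum_norm_lt_re P' (by linarith)
  have hU : (fun t => Es s (γ t) / ∏ p ∈ P, (s - p)) = fun t => eisensteinFamilyDelta L e dV hdV dW hdW f s (γ t) := by
    funext t'
    rw [hiv s _ hsn, mul_div_cancel_left₀ _ (prod_sub_ne_zero P hsP)]
  have hW : E' s (γ t) / ∏ p ∈ P', (s - p) = eisensteinFamilyDelta L e dV hdV dW hdW f' s (γ t) := by
    rw [hiv' s _ hsn, mul_div_cancel_left₀ _ (prod_sub_ne_zero P' hsP')]
  rw [hU, hW]
  exact hasDerivAt_eisensteinFamilyDelta_orbit L e dV hdV dW hdW f f' γ hX hsum hmaj s hs₁ t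

/-- **THE ASSEMBLED G1 CHAIN, continuation**: §G2-OUT + #9-type majorants + #41 clauses (i) [for `f`] and (i)(ii)(iv)(v) [for `f′`], (iv) [for `f`] + an orbit with
two-sided segment height bounds ⊢ `∂_t [E⋆(s, γ t)·∏_{P′}(s − p)] = E′(s, γ t)·∏_P(s − p)` at EVERY `s ∈ {0 < re}` (★ G1 file 1). [cite: MoeglinWaldspurger1995, IV.1.9–IV.1.11] -/
theorem hasDerivAt_continuation_orbit_of_termwise (f f' : ℂ → HA L e dV hdV dW hdW → ℂ) (γ : ℝ → HA L e dV hdV dW hdW)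
    (hγc : Continuous γ)
    (hγ : ∀ R : ℝ, ∃ B₁ B₂ : ℝ, 0 < B₁ ∧ ∀ t : ℝ, |t| ≤ R →
      B₁ ≤ adelicHeightGL (n + n) L ((γ t : HA L e dV hdV dW hdW) : GL (Fin (n + n)) (AdeleRing (𝓞 L) L)) ∧
        adelicHeightGL (n + n) L ((γ t : HA L e dV hdV dW hdW) : GL (Fin (n + n)) (AdeleRing (𝓞 L) L)) ≤ B₂)
    (hX : ∀ (s : ℂ) (h : HA L e dV hdV dW hdW) (t : ℝ), HasDerivAt (fun t => f s (h * γ t)) (f' s (h * γ t)) t)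
    {s₁ : ℝ} (hs₁ : 0 ≤ s₁)
    (hsum : ∀ s : ℂ, s₁ < s.re → Summable fun q : SiegelDeltaQuot L e dV hdV dW hdW =>
      f s (((Quotient.out q : ratH L e dV hdV dW hdW) : HA L e dV hdV dW hdW) * γ 0))
    (hmaj : ∀ s : ℂ, s₁ < s.re → ∀ R : ℝ, ∃ u : SiegelDeltaQuot L e dV hdV dW hdW → ℝ, Summable u ∧
      ∀ t : ℝ, |t| < R → ∀ q : SiegelDeltaQuot L e dV hdV dW hdW,
        ‖f' s (((Quotient.out q : ratH L e dV hdV dW hdW) : HA L e dV hdV dW hdW) * γ t)‖ ≤ u q)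
    (P : Finset ℂ) (Es : ℂ → HA L e dV hdV dW hdW → ℂ)
    (hd : ∀ h : HA L e dV hdV dW hdW, DifferentiableOn ℂ (fun s => Es s h) {s : ℂ | 0 < s.re})
    (hiv : ∀ (s : ℂ) (h : HA L e dV hdV dW hdW), (n : ℝ) / 2 < s.re →
      Es s h = (∏ p ∈ P, (s - p)) * eisensteinFamilyDelta L e dV hdV dW hdW f s h)
    (P' : Finset ℂ) (E' : ℂ → HA L e dV hdV dW hdW → ℂ)
    (hd' : ∀ h : HA L e dV hdV dW hdW, DifferentiableOn ℂ (fun s => E' s h) {s : ℂ | 0 < s.re})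
    (hii' : ∀ s : ℂ, 0 < s.re → Continuous (E' s))
    (hiv' : ∀ (s : ℂ) (h : HA L e dV hdV dW hdW), (n : ℝ) / 2 < s.re →
      E' s h = (∏ p ∈ P', (s - p)) * eisensteinFamilyDelta L e dV hdV dW hdW f' s h)
    (hv' : ∀ z : ℂ, 0 < z.re → ∃ C A r : ℝ, 0 < r ∧ ∀ s : ℂ, dist s z < r → ∀ h : HA L e dV hdV dW hdW,
      ‖E' s h‖ ≤ C * adelicHeightGL (n + n) L (h : GL (Fin (n + n)) (AdeleRing (𝓞 L) L)) ^ A)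
    (s : ℂ) (hs : 0 < s.re) (t : ℝ) :
    HasDerivAt (fun t => Es s (γ t) * ∏ p ∈ P', (s - p)) (E' s (γ t) * ∏ p ∈ P, (s - p)) t := by
  have hP0 : 0 ≤ ∑ p ∈ P, ‖p‖ := Finset.sum_nonneg fun p _ => norm_nonneg p
  have hP0' : 0 ≤ ∑ p ∈ P', ‖p‖ := Finset.sum_nonneg fun p _ => norm_nonneg p
  have hn0 : (0 : ℝ) ≤ (n : ℝ) / 2 := by positivity
  exact hasDerivAt_continuation_orbit L e dV hdV dW hdW P Es hd P' E' hd' hii' hv' γ hγc hγ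
    (s₁ := max s₁ ((n : ℝ) / 2) + (∑ p ∈ P, ‖p‖ + ∑ p ∈ P', ‖p‖))
    (by linarith [le_max_left s₁ ((n : ℝ) / 2)])
    (hterm_of_termwise L e dV hdV dW hdW f f' γ hX hsum hmaj P Es hiv P' E' hiv') s hs t

/-- **THE ASSEMBLED G1 CHAIN, residue form (SIGS §G1.3 in BY-VALUE currency)**: same data ⊢ `HasDerivAt (fun t => resNorm P E⋆ (γ t)) (resNorm P′ E′ (γ t)) t`
(★ G1 file 2).  With G2's discharge of `hX` for Siegel–Weil families (`f′ = g_{ω(X)Φ} + (s − ½)·Σ cᵢ(s) g_{Φᵢ}`) this is `∂_t res(g_Φ)(h e^{tX}) = res(g_{ω(X)Φ})(h)` — the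
`(s − ½)`-terms contribute `0` to `resNorm P′ E′` by ★ U0.4. [cite: KudlaRallis1994, §1 Thm. 1.1] [cite: MoeglinWaldspurger1995, IV.1.9–IV.1.11] [cite: Liu2021, Lem. B.12] -/
theorem hasDerivAt_resNorm_orbit_of_termwise (f f' : ℂ → HA L e dV hdV dW hdW → ℂ) (γ : ℝ → HA L e dV hdV dW hdW)
    (hγc : Continuous γ)
    (hγ : ∀ R : ℝ, ∃ B₁ B₂ : ℝ, 0 < B₁ ∧ ∀ t : ℝ, |t| ≤ R →
      B₁ ≤ adelicHeightGL (n + n) L ((γ t : HA L e dV hdV dW hdW) : GL (Fin (n + n)) (AdeleRing (𝓞 L) L)) ∧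
        adelicHeightGL (n + n) L ((γ t : HA L e dV hdV dW hdW) : GL (Fin (n + n)) (AdeleRing (𝓞 L) L)) ≤ B₂)
    (hX : ∀ (s : ℂ) (h : HA L e dV hdV dW hdW) (t : ℝ), HasDerivAt (fun t => f s (h * γ t)) (f' s (h * γ t)) t)
    {s₁ : ℝ} (hs₁ : 0 ≤ s₁)
    (hsum : ∀ s : ℂ, s₁ < s.re → Summable fun q : SiegelDeltaQuot L e dV hdV dW hdW =>
      f s (((Quotient.out q : ratH L e dV hdV dW hdW) : HA L e dV hdV dW hdW) * γ 0))
    (hmaj : ∀ s : ℂ, s₁ < s.re → ∀ R : ℝ, ∃ u : SiegelDeltaQuot L e dV hdV dW hdW → ℝ, Summable u ∧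
      ∀ t : ℝ, |t| < R → ∀ q : SiegelDeltaQuot L e dV hdV dW hdW,
        ‖f' s (((Quotient.out q : ratH L e dV hdV dW hdW) : HA L e dV hdV dW hdW) * γ t)‖ ≤ u q)
    (P : Finset ℂ) (Es : ℂ → HA L e dV hdV dW hdW → ℂ)
    (hd : ∀ h : HA L e dV hdV dW hdW, DifferentiableOn ℂ (fun s => Es s h) {s : ℂ | 0 < s.re})
    (hiv : ∀ (s : ℂ) (h : HA L e dV hdV dW hdW), (n : ℝ) / 2 < s.re →
      Es s h = (∏ p ∈ P, (s - p)) * eisensteinFamilyDelta L e dV hdV dW hdW f s h)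
    (P' : Finset ℂ) (E' : ℂ → HA L e dV hdV dW hdW → ℂ)
    (hd' : ∀ h : HA L e dV hdV dW hdW, DifferentiableOn ℂ (fun s => E' s h) {s : ℂ | 0 < s.re})
    (hii' : ∀ s : ℂ, 0 < s.re → Continuous (E' s))
    (hiv' : ∀ (s : ℂ) (h : HA L e dV hdV dW hdW), (n : ℝ) / 2 < s.re →
      E' s h = (∏ p ∈ P', (s - p)) * eisensteinFamilyDelta L e dV hdV dW hdW f' s h)
    (hv' : ∀ z : ℂ, 0 < z.re → ∃ C A r : ℝ, 0 < r ∧ ∀ s : ℂ, dist s z < r → ∀ h : HA L e dV hdV dW hdW,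
      ‖E' s h‖ ≤ C * adelicHeightGL (n + n) L (h : GL (Fin (n + n)) (AdeleRing (𝓞 L) L)) ^ A)
    (t : ℝ) :
    HasDerivAt (fun t => resNorm P Es (γ t)) (resNorm P' E' (γ t)) t := by
  have hP0 : 0 ≤ ∑ p ∈ P, ‖p‖ := Finset.sum_nonneg fun p _ => norm_nonneg p
  have hP0' : 0 ≤ ∑ p ∈ P', ‖p‖ := Finset.sum_nonneg fun p _ => norm_nonneg p
  have hn0 : (0 : ℝ) ≤ (n : ℝ) / 2 := by positivity
  exact hasDerivAt_resNorm_orbit L e dV hdV dW hdW P Es hd P' E' hd' hii' hv' γ hγc hγ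
    (s₁ := max s₁ ((n : ℝ) / 2) + (∑ p ∈ P, ‖p‖ + ∑ p ∈ P', ‖p‖))
    (by linarith [le_max_left s₁ ((n : ℝ) / 2)])
    (hterm_of_termwise L e dV hdV dW hdW f f' γ hX hsum hmaj P Es hiv P' E' hiv') t

end Frame

end Summit.HodgeConjecture.HodgeConjecture.Cruxes.HLiu418.K2LiuEisensteinTermwiseLieDerivative

end
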